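import Mathlib
import Summits.Ventures.PercRepro2.Defs
import Summits.Ventures.PercRepro2.Graph
import Summits.Ventures.PercRepro2.OneColourSwitch
import Summits.Ventures.PercRepro2.RegionHubSign
import Summits.Ventures.PercRepro2.SideSwitch
import Summits.Ventures.PercRepro2.TermSwitchDefs
import Summits.Ventures.PercRepro2.TermSwitchM9
import Summits.Ventures.PercRepro2.M9NoPocketDefs
import Summits.Ventures.PercRepro2.M9DAvoid
import Summits.Ventures.PercRepro2.M9DAvoidSplit
import Summits.Ventures.PercRepro2.M9RegionSplit
import Summits.Ventures.PercRepro2.M9SingleDPocket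
import Summits.Ventures.PercRepro2.M9DeadEnd

/-!
# The trichotomy of the `d`-avoiding sum: `T1 = 2·S1 + Σ_Γ` (blind cell PercRepro2, p3 g24,
2026-08-28; `proofs/P3-CONJG.md` §2)

With an edge `d–r` present, every colouring has `d ∈ K₂ ∪ M₂`, so the `Sep ∧ DOne` colourings
split into `d ∉ M₂` (every `T`-edge `Y`, `σ_rs = 1 − 1[r ~_W s in G − d]`), `d ∉ K₂` (the mirror)
and `d ∈ K₂ ∩ M₂` (`p, q` joined to `d` in neither colour, so `σ̃_pq = σ_pq`).  The colour flip
identifies the first two parts: `dSignSumAvoid = 2·sOneSum + gammaSum`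
(`dSignSumAvoid_eq_two_sOne_add_gamma`) with the one-sided sum
`sOneSum = Σ_{Sep ∧ DOne ∧ d ∉ M₂ ∧ r ≁_W s in G−d} σ̃_pq` and the doubly-reached sum
`gammaSum = Σ_{Sep ∧ DOne ∧ d ∈ K₂ ∧ d ∈ M₂} σ_pq · σ_rs`.  Own work; std axioms.
-/

namespace Summit.Ventures.PercRepro2

namespace NoPocket

open Finset Classical RegionHub OneColourSwitch SideSwitch TermSwitch

variable {V : Type*} {E : Type*}

section Sums

variable [Fintype E] [DecidableEq E]
variable (ends : E → Sym2 V)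

/-- The one-sided sum `S1 := Σ_{Sep ∧ DOne ∧ d ∉ M₂ ∧ r ≁_W s in G − d} σ̃_pq`. -/
noncomputable def sOneSum (p q r s d : V) : ℤ :=
  ∑ ω : Config E, if sep2 ends p q r s ω ∧ DOne ends r s d ω ∧ d ∉ M2 ends r s ω ∧
      ¬ Conn (endsD ends d) (OneColourSwitch.compl ω) r s then
    sigma (endsD ends d) ω p q else 0

/-- The mirror one-sided sum `Σ_{Sep ∧ DOne ∧ d ∉ K₂ ∧ r ≁_Y s in G − d} (−σ̃_pq)`. -/
noncomputable def sOneSum' (p q r s d : V) : ℤ :=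
  ∑ ω : Config E, if sep2 ends p q r s ω ∧ DOne ends r s d ω ∧ d ∉ K2 ends r s ω ∧
      ¬ Conn (endsD ends d) ω r s then
    - sigma (endsD ends d) ω p q else 0

/-- The doubly-reached sum `Σ_Γ := Σ_{Sep ∧ DOne ∧ d ∈ K₂ ∧ d ∈ M₂} σ_pq · σ_rs`. -/
noncomputable def gammaSum (p q r s d : V) : ℤ :=
  ∑ ω : Config E, if sep2 ends p q r s ω ∧ DOne ends r s d ω ∧ d ∈ K2 ends r s ω ∧
      d ∈ M2 ends r s ω then
    sigma ends ω p q * sigma ends ω r s else 0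

variable {ends}

omit [Fintype E] [DecidableEq E] in
/-- On a `Sep`-colouring with `d` in both worlds, `p, q` are separated from the terminal set
`{r, s, d}`. -/
lemma sepH_of_sep2_of_mem_both {p q r s d : V} {ω : Config E} (hsep : sep2 ends p q r s ω)
    (hK : d ∈ K2 ends r s ω) (hM : d ∈ M2 ends r s ω) :
    sepH ends p q ({r, s, d} : Set V) ω := by
  obtain ⟨⟨hpr, hps, hqr, hqs⟩, ⟨hpr', hps', hqr', hqs'⟩⟩ := hsep
  refine ⟨?_, ?_, ?_, ?_⟩
  · intro h
    rcases mem_KH_triple.1 h with h | h | h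
    · exact hpr (conn_symm h)
    · exact hps (conn_symm h)
    · rcases mem_K2_iff.1 hK with hd | hd
      · exact hpr (conn_symm (conn_trans hd h))
      · exact hps (conn_symm (conn_trans hd h))
  · intro h
    rcases mem_KH_triple.1 h with h | h | h
    · exact hqr (conn_symm h)
    · exact hqs (conn_symm h)
    · rcases mem_K2_iff.1 hK with hd | hd
      · exact hqr (conn_symm (conn_trans hd h))
      · exact hqs (conn_symm (conn_trans hd h))
  · intro h
    rcases mem_KH_triple.1 h with h | h | h
    · exact hpr' (conn_symm h)
    · exact hps' (conn_symm h)
    · rcases mem_M2_iff.1 hM with hd | hd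
      · exact hpr' (conn_symm (conn_trans hd h))
      · exact hps' (conn_symm (conn_trans hd h))
  · intro h
    rcases mem_KH_triple.1 h with h | h | h
    · exact hqr' (conn_symm h)
    · exact hqs' (conn_symm h)
    · rcases mem_M2_iff.1 hM with hd | hd
      · exact hqr' (conn_symm (conn_trans hd h))
      · exact hqs' (conn_symm (conn_trans hd h))

/-- **The three-way split** `dSignSumAvoid = sOneSum + sOneSum' + gammaSum`. -/
theorem dSignSumAvoid_eq_three (p q r s d : V) {er es : E}
    (her : ends er = s(d, r)) (hes : ends es = s(d, s)) :
    dSignSumAvoid ends p q r s d =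
      sOneSum ends p q r s d + sOneSum' ends p q r s d + gammaSum ends p q r s d := by
  unfold dSignSumAvoid sOneSum sOneSum' gammaSum
  rw [← Finset.sum_add_distrib, ← Finset.sum_add_distrib]
  refine Finset.sum_congr rfl fun ω _ => ?_
  by_cases hsd : sep2 ends p q r s ω ∧ DOne ends r s d ω
  · obtain ⟨hsep, hD⟩ := hsd
    by_cases hM : d ∈ M2 ends r s ω
    · by_cases hK : d ∈ K2 ends r s ω
      · -- doubly reached
        have hH := sepH_of_sep2_of_mem_both hsep hK hM
        have h1 : ¬ (sep2 ends p q r s ω ∧ DOne ends r s d ω ∧ d ∉ M2 ends r s ω ∧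
            ¬ Conn (endsD ends d) (OneColourSwitch.compl ω) r s) := fun h => h.2.2.1 hM
        have h2 : ¬ (sep2 ends p q r s ω ∧ DOne ends r s d ω ∧ d ∉ K2 ends r s ω ∧
            ¬ Conn (endsD ends d) ω r s) := fun h => h.2.2.1 hK
        have h3 : sep2 ends p q r s ω ∧ DOne ends r s d ω ∧ d ∈ K2 ends r s ω ∧
            d ∈ M2 ends r s ω := ⟨hsep, hD, hK, hM⟩
        have hsd' : sep2 ends p q r s ω ∧ DOne ends r s d ω := ⟨hsep, hD⟩
        rw [if_pos hsd', if_neg h1, if_neg h2, if_pos h3, sigma_endsD_eq_of_sepH hH]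
        ring
      · -- `d ∉ K₂`: every `T`-edge is `W`
        have hσ := sigma_rs_of_not_mem_K2 hK her hes
        have h1 : ¬ (sep2 ends p q r s ω ∧ DOne ends r s d ω ∧ d ∉ M2 ends r s ω ∧
            ¬ Conn (endsD ends d) (OneColourSwitch.compl ω) r s) := fun h => h.2.2.1 hM
        have h3 : ¬ (sep2 ends p q r s ω ∧ DOne ends r s d ω ∧ d ∈ K2 ends r s ω ∧
            d ∈ M2 ends r s ω) := fun h => hK h.2.2.1
        have hsd' : sep2 ends p q r s ω ∧ DOne ends r s d ω := ⟨hsep, hD⟩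
        rw [if_pos hsd', if_neg h1, if_neg h3, hσ]
        by_cases hc : Conn (endsD ends d) ω r s
        · have h2 : ¬ (sep2 ends p q r s ω ∧ DOne ends r s d ω ∧ d ∉ K2 ends r s ω ∧
              ¬ Conn (endsD ends d) ω r s) := fun h => h.2.2.2 hc
          rw [if_neg h2, if_pos hc]
          ring
        · have h2 : sep2 ends p q r s ω ∧ DOne ends r s d ω ∧ d ∉ K2 ends r s ω ∧
              ¬ Conn (endsD ends d) ω r s := ⟨hsep, hD, hK, hc⟩
          rw [if_pos h2, if_neg hc]
          ring
    · -- `d ∉ M₂`: every `T`-edge is `Y`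
      have hK : d ∈ K2 ends r s ω := (mem_K2_or_mem_M2 ω her).resolve_right hM
      have hσ := sigma_rs_of_not_mem_M2 hM her hes
      have h2 : ¬ (sep2 ends p q r s ω ∧ DOne ends r s d ω ∧ d ∉ K2 ends r s ω ∧
          ¬ Conn (endsD ends d) ω r s) := fun h => h.2.2.1 hK
      have h3 : ¬ (sep2 ends p q r s ω ∧ DOne ends r s d ω ∧ d ∈ K2 ends r s ω ∧
          d ∈ M2 ends r s ω) := fun h => hM h.2.2.2
      have hsd' : sep2 ends p q r s ω ∧ DOne ends r s d ω := ⟨hsep, hD⟩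
      rw [if_pos hsd', if_neg h2, if_neg h3, hσ]
      by_cases hc : Conn (endsD ends d) (OneColourSwitch.compl ω) r s
      · have h1 : ¬ (sep2 ends p q r s ω ∧ DOne ends r s d ω ∧ d ∉ M2 ends r s ω ∧
            ¬ Conn (endsD ends d) (OneColourSwitch.compl ω) r s) := fun h => h.2.2.2 hc
        rw [if_neg h1, if_pos hc]
        ring
      · have h1 : sep2 ends p q r s ω ∧ DOne ends r s d ω ∧ d ∉ M2 ends r s ω ∧
            ¬ Conn (endsD ends d) (OneColourSwitch.compl ω) r s := ⟨hsep, hD, hM, hc⟩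
        rw [if_pos h1, if_neg hc]
        ring
  · have h1 : ¬ (sep2 ends p q r s ω ∧ DOne ends r s d ω ∧ d ∉ M2 ends r s ω ∧
        ¬ Conn (endsD ends d) (OneColourSwitch.compl ω) r s) := fun h => hsd ⟨h.1, h.2.1⟩
    have h2 : ¬ (sep2 ends p q r s ω ∧ DOne ends r s d ω ∧ d ∉ K2 ends r s ω ∧
        ¬ Conn (endsD ends d) ω r s) := fun h => hsd ⟨h.1, h.2.1⟩
    have h3 : ¬ (sep2 ends p q r s ω ∧ DOne ends r s d ω ∧ d ∈ K2 ends r s ω ∧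
        d ∈ M2 ends r s ω) := fun h => hsd ⟨h.1, h.2.1⟩
    rw [if_neg hsd, if_neg h1, if_neg h2, if_neg h3]
    ring

/-- **The mirror one-sided sum equals the one-sided sum** (colour flip). -/
theorem sOneSum'_eq (p q r s d : V) : sOneSum' ends p q r s d = sOneSum ends p q r s d := by
  unfold sOneSum' sOneSum
  rw [← sum_compl' (fun ω => if sep2 ends p q r s ω ∧ DOne ends r s d ω ∧ d ∉ K2 ends r s ω ∧
      ¬ Conn (endsD ends d) ω r s then - sigma (endsD ends d) ω p q else 0)]
  refine Finset.sum_congr rfl fun ω _ => ?_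
  simp only [sep2_compl, DOne_compl_iff, K2_compl, sigma_compl', neg_neg]

/-- **The trichotomy identity** `T1 = 2·S1 + Σ_Γ`: on every graph with edges `d–r`, `d–s`,
`dSignSumAvoid = 2·sOneSum + gammaSum`. -/
theorem dSignSumAvoid_eq_two_sOne_add_gamma (p q r s d : V) {er es : E}
    (her : ends er = s(d, r)) (hes : ends es = s(d, s)) :
    dSignSumAvoid ends p q r s d = 2 * sOneSum ends p q r s d + gammaSum ends p q r s d := by
  rw [dSignSumAvoid_eq_three p q r s d her hes, sOneSum'_eq]
  ring

end Sums

end NoPocket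

end Summit.Ventures.PercRepro2
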